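import Summits.Ventures.CertifiedManyBodySolver.Downfold.EmeryShapeTrueCornerBand
import Summits.Ventures.CertifiedManyBodySolver.Downfold.EmeryFermiScalePointsLa214SOLX003TrueCorners
import Summits.Ventures.CertifiedManyBodySolver.Downfold.EmeryFermiScalePointsLa214SOLX005TrueCorners
import HarnessLib

/-!
# THE ONE-BAND FERMI-SURFACE SHAPE `t′/t` OF THE TYPED 3BE BOX `emeryBoxLa214v123 ∩ {Δ_pd ∈ [3.24, 4.0]} (solver-level Δ tag)` OVER A DOPING BAND, AT ITS TWO TRUE CORNERS (true-corner rule, band form, §B.87 (j) —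
# the t′/t leg of the §B.98 doping-continuum image; router/ONE-BAND-IMAGE-BANDS.tsv)

Venture CertifiedManyBodySolver, cell `pub/hubbard-downfold` (stage S1; INFLATION-RULES-3to1-B §B.87 (j)), seat hubbard-downfold-mod-4 (technique B, g43; generator = g35 truecorner_band.py re-run per (Δ tag, doping band) for §B.98); namespace
`Summit.Ventures.CertifiedManyBodySolver.Downfold.Emery`. Everything PROVED (0 sorry; no new certificate — the end-filling brackets of the per-filling files are re-read).
WHAT THIS IS NOT: a statement about La₂₋ₓSrₓCuO₄ (box #18) — the typed box is SCREENING-GRADE; `U = 0` one-body kinematics of the σ model (rigid band).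

For EVERY one-body row of `[3.24, 4] × [1.29, 1.52] × [0.46, 0.66] × [0.12, 0.15]` eV AND EVERY filling `ν ∈ [19/40, 97/200]` the one-band `t′/t` lies in **[-0.2464, -0.1676]**: the true-corner
squeeze `fsRatio_fermiEnergyOf_trueCorner_lower_band` / `…_upper_band` (`EmeryShapeTrueCornerBand`: slab windows `[pL, qL] = [13711/10000, 14701/10000]`, `[pU, qU] = [15749/10000, 4173/2500]`, regime `qT = 9349/5000`
certified at the END fillings; margin constants lower slab M_b 0.2633 / M_c 0.3742, upper slab M_b 4.0341 / M_c 0.0), read at the true corners over their band windows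
`[14207/10000, 2901/2000]` (antitone) and `[797/500, 3243/2000]` (monotone) (`fermiEnergyOf_mem_Icc_of_band`). (Per-column comparators: the landed `…fsRatio_true_<x>` theorems at the two end fillings.)

Sources: three-band model [HybertsenSchluterChristensen1989, Eq. (1)]; [AndersenEtAl1995, §6]; box rows as cited in the typed object's file.
-/

noncomputable section

namespace Summit.Ventures.CertifiedManyBodySolver.Downfold.Emery

open Real Set

/-- **filling band ν ∈ [19/40, 97/200] (x = 0.05 … x = 0.03): for every row of the box AND every filling of the band the one-band Fermi-surface `t′/t` (object E) lies in `[-0.2464, -0.1676]` — between its values at the two TRUE corners** (band form of the true-corner rule; margins by `norm_num`). [folklore] -/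
theorem la214SOLBox_fsRatio_true_band_x003_x005 {Δ a b c ν : ℝ} (hΔ : Δ ∈ Icc ((81 : ℝ) / 25) (4 : ℝ)) (ha : a ∈ Icc ((129 : ℝ) / 100) ((38 : ℝ) / 25)) (hb : b ∈ Icc ((23 : ℝ) / 50) ((33 : ℝ) / 50)) (hc : c ∈ Icc ((3 : ℝ) / 25) ((3 : ℝ) / 20)) (hν : ν ∈ Icc ((19 : ℝ) / 40) ((97 : ℝ) / 200)) :
    fsRatio Δ a b c (fermiEnergyOf Δ a b c ν) ∈ Icc ((-154 : ℝ) / 625) ((-419 : ℝ) / 2500) := by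
  have hSL := (fermiEnergyOf_of_pointBracketCheck truePt_La214SOLX005SL_x005_br (by norm_num) (by norm_num) (by norm_num) (ν := (19/40 : ℝ)) (by push_cast; exact ⟨le_rfl, le_rfl⟩)).2
  have hAlo := (fermiEnergyOf_of_pointBracketCheck truePt_La214SOLX003AL_x003_br (by norm_num) (by norm_num) (by norm_num) (ν := (97/200 : ℝ)) (by push_cast; exact ⟨le_rfl, le_rfl⟩)).2
  have hTop := (fermiEnergyOf_of_pointBracketCheck truePt_La214SOLX003HH_x003_br (by norm_num) (by norm_num) (by norm_num) (ν := (97/200 : ℝ)) (by push_cast; exact ⟨le_rfl, le_rfl⟩)).2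
  have hSU := (fermiEnergyOf_of_pointBracketCheck truePt_La214SOLX005SU_x005_br (by norm_num) (by norm_num) (by norm_num) (ν := (19/40 : ℝ)) (by push_cast; exact ⟨le_rfl, le_rfl⟩)).2
  have hQU := (fermiEnergyOf_of_pointBracketCheck truePt_La214SOLX003QU_x003_br (by norm_num) (by norm_num) (by norm_num) (ν := (97/200 : ℝ)) (by push_cast; exact ⟨le_rfl, le_rfl⟩)).2
  have hTL1 := (fermiEnergyOf_of_pointBracketCheck truePt_La214SOLX005TL_x005_br (by norm_num) (by norm_num) (by norm_num) (ν := (19/40 : ℝ)) (by push_cast; exact ⟨le_rfl, le_rfl⟩)).2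
  have hTL2 := (fermiEnergyOf_of_pointBracketCheck truePt_La214SOLX003TL_x003_br (by norm_num) (by norm_num) (by norm_num) (ν := (97/200 : ℝ)) (by push_cast; exact ⟨le_rfl, le_rfl⟩)).2
  have hTH1 := (fermiEnergyOf_of_pointBracketCheck truePt_La214SOLX005TH_x005_br (by norm_num) (by norm_num) (by norm_num) (ν := (19/40 : ℝ)) (by push_cast; exact ⟨le_rfl, le_rfl⟩)).2
  have hTH2 := (fermiEnergyOf_of_pointBracketCheck truePt_La214SOLX003TH_x003_br (by norm_num) (by norm_num) (by norm_num) (ν := (97/200 : ℝ)) (by push_cast; exact ⟨le_rfl, le_rfl⟩)).2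
  push_cast at hSL hAlo hTop hSU hQU hTL1 hTL2 hTH1 hTH2
  norm_num at hSL hAlo hTop hSU hQU hTL1 hTL2 hTH1 hTH2
  obtain ⟨hΔl, hΔu⟩ := hΔ
  obtain ⟨hal, hau⟩ := ha
  have hTL := fermiEnergyOf_mem_Icc_of_band (Δ := ((81 : ℝ) / 25)) (a := ((129 : ℝ) / 100)) (b := ((33 : ℝ) / 50)) (c := ((3 : ℝ) / 20)) (e₁ := ((14207 : ℝ) / 10000)) (e₂ := ((2901 : ℝ) / 2000)) (by norm_num) (by norm_num) (by norm_num) (by norm_num) (by norm_num) hν (by norm_num) hTL1.1 hTL2.2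
  have hTH := fermiEnergyOf_mem_Icc_of_band (Δ := (4 : ℝ)) (a := ((38 : ℝ) / 25)) (b := ((23 : ℝ) / 50)) (c := ((3 : ℝ) / 25)) (e₁ := ((797 : ℝ) / 500)) (e₂ := ((3243 : ℝ) / 2000)) (by norm_num) (by norm_num) (by norm_num) (by norm_num) (by norm_num) hν (by norm_num) hTH1.1 hTH2.2
  constructor
  · have hlow := fsRatio_fermiEnergyOf_trueCorner_lower_band (Δ₁ := ((81 : ℝ) / 25)) (a₁ := ((129 : ℝ) / 100)) (b₁ := ((23 : ℝ) / 50)) (b₂ := ((33 : ℝ) / 50)) (c₁ := ((3 : ℝ) / 25)) (c₂ := ((3 : ℝ) / 20)) (ν₁ := ((19 : ℝ) / 40)) (ν₂ := ((97 : ℝ) / 200))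
      (pL := ((13711 : ℝ) / 10000)) (qL := ((14701 : ℝ) / 10000)) (Mb := ((2633 : ℝ) / 10000)) (Mc := ((1871 : ℝ) / 5000)) (by norm_num) hΔl (by norm_num) hal (by norm_num) hb (by norm_num) hc (by norm_num) (by norm_num) hν (by norm_num)
      (by norm_num) hSL.1 hAlo.2 (by norm_num) (by norm_num [fsD, fsN]) (by norm_num) (by norm_num) (by norm_num [fsD, fsN]) (by norm_num) (by norm_num [dopingDisc]) (by norm_num [fsD, fsN])
    refine le_trans ?_ hlow
    have hw := (fsRatio_mem_Icc_on_window_of_dopingDisc_nonneg (Δ := ((81 : ℝ) / 25)) (a := ((129 : ℝ) / 100)) (b := ((33 : ℝ) / 50)) (c := ((3 : ℝ) / 20))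
      (p := ((14207 : ℝ) / 10000)) (q := ((2901 : ℝ) / 2000)) (by norm_num) (by norm_num) (by norm_num) (by norm_num) (by norm_num) (by norm_num) (by norm_num) (by norm_num [dopingDisc]) hTL).1
    refine le_trans ?_ hw
    norm_num [fsRatio, fsD, fsN]
  · have hup := fsRatio_fermiEnergyOf_trueCorner_upper_band (Δ₁ := ((81 : ℝ) / 25)) (Δ₂ := (4 : ℝ)) (a₁ := ((129 : ℝ) / 100)) (a₂ := ((38 : ℝ) / 25)) (b₁ := ((23 : ℝ) / 50)) (b₂ := ((33 : ℝ) / 50)) (c₁ := ((3 : ℝ) / 25)) (c₂ := ((3 : ℝ) / 20)) (ν₁ := ((19 : ℝ) / 40)) (ν₂ := ((97 : ℝ) / 200))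
      (pU := ((15749 : ℝ) / 10000)) (qU := ((4173 : ℝ) / 2500)) (qT := ((9349 : ℝ) / 5000)) (Mb := ((40341 : ℝ) / 10000)) (Mc := (0 : ℝ)) (by norm_num) ⟨hΔl, hΔu⟩ (by norm_num) ⟨hal, hau⟩ (by norm_num) hb (by norm_num) hc (by norm_num) (by norm_num) hν (by norm_num)
      hTop.2 (by norm_num) (by norm_num) hSU.1 hQU.2 (by norm_num) (by norm_num [fsD, fsN]) (by norm_num) (by norm_num) (by norm_num [fsD, fsN]) (by norm_num) (by norm_num) (by norm_num [fsD, fsN])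
    refine le_trans hup ?_
    have hw := (fsRatio_mem_Icc_on_window_of_dopingDisc_nonpos (Δ := (4 : ℝ)) (a := ((38 : ℝ) / 25)) (b := ((23 : ℝ) / 50)) (c := ((3 : ℝ) / 25))
      (p := ((797 : ℝ) / 500)) (q := ((3243 : ℝ) / 2000)) (by norm_num) (by norm_num) (by norm_num) (by norm_num) (by norm_num) (by norm_num) (by norm_num) (by norm_num [dopingDisc]) hTH).2
    refine le_trans hw ?_
    norm_num [fsRatio, fsD, fsN]

end Summit.Ventures.CertifiedManyBodySolver.Downfold.Emery
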